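import Summits.BirchSwinnertonDyer.BirchSwinnertonDyer.Theorems.PrintCf2SplitBadTwoLineSignModuleCocycle
import Summits.BirchSwinnertonDyer.BirchSwinnertonDyer.Theorems.PrintCf2SplitBadTwoLineLocalGroupAtRamified
import Literature.NumberTheory.EllipticCurves.BigRepModuleShapiroSelmerConditionsProofs
import Literature.NumberTheory.EllipticCurves.Rubin1991.TwoVariableSelmerCoefficientTwist
import HarnessLib

/-!
# Road α, crux `PrintCf2.SplitBadTwoRankOneOfFacts` (stmt-BirchSwinnertonDyer-20368), brick (RES)(b2-ii), file 3/3: at a place RAMIFIED in a `ℤ_p`-line,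
# UNRAMIFIED = STRICT for a sign module with a non-inertial mover — `greenbergKer (M⁺_w = 0) = awayKer` on `H¹(ker κ, M)`

Cell `bsd-print-cf2`, width seat `bsd-line-cf2-p1-w6` g4; `--supports stmt-BirchSwinnertonDyer-20368 --as helper`. HONEST FRAMING: nothing here
closes the crux or a registered stub; no summit statement is proved by this seat; BSD is not proved by any of this. No definition, no named
fact, no `sorry`.

Setting of (RES)(b2) (cf2c-w8 g0's TURNKEY `Cruxes/RestrictedMainConjWithValueAtTwo/RES-LOCAL-DEFECT-cf2c-w8.md` §2 (V̄), corrected by p685012):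
over the line `K*_∞ = K̄^{ker κ₂}` the Greenberg group `S_{W*}(K*_∞)` (= `J`, p685638) and Agboola's `𝔖_v̄(K*_∞, W*)` differ ABOVE `v̄` by
`Def(v̄) = ker (H¹(ker κ₂ ⊓ D_v̄, W*) → H¹(ker κ₂ ⊓ I_v̄, W*))`; by (C3) `ker κ₂` acts on `W*` through `{±1}`. `Def(v̄) = 0` exactly when
`ker κ₂ ⊓ I_v̄` acts trivially on `W*` and some `δ₀ ∈ ker κ₂ ⊓ D_v̄` acts as `−1` («mover outside inertia»: road α `d ≡ 7 (mod 8)`, `d ≡ 6 (mod 16)`);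
`Def(v̄) ≅ ℤ/2` for an inertial mover (`d ≡ 2, 10 (mod 16)`); `Def(v̄) ⊇ Hom_cont(Ẑ, W*) ≅ ℚ₂/ℤ₂` when `ker κ₂ ⊓ D_v̄` acts trivially
(`d ≡ 3 (mod 8)`, `d ≡ 14 (mod 16)`).

THIS FILE assembles files 1/3 (p687174 `exists_eq_smul_sub_of_mover`) and 2/3 (p687207 `commutator_mem_galUnr`, `isOpen_comap_kerSubgroup_sup_galUnr`,
`eq_of_isOpen_of_index_two`) on `H_F = res⁻¹(ker κ) ≤ Γ_{K_w}`, `N = H_F ⊓ I_F`, pulling the class back along `res` exactly as in p686165: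
* **`resOfLe_inf_decomp_eq_zero_of_mover`** — `κ` a `ℤ_p`-line RAMIFIED at `w`, `M` discrete with open stabilisers, `2`-divisible, at most one element of
  order `2`, `ker κ` acting through signs, `ker κ ⊓ I_w` acting trivially, a mover `δ₀ ∈ ker κ ⊓ D_w`: for `y ∈ H¹(ker κ, M)`,
  `res_{ker κ ⊓ I_w} y = 0 → res_{ker κ ⊓ D_w} y = 0`;
* **`greenbergKer_strictDatum_eq_awayKer_of_mover`** — hence `(strictDatum M w).greenbergKer (ker κ) = awayKer (ker κ) M w`
  (`mem_greenbergKer_strictDatum_iff_resOfLe`, `BigGaloisRep.strictKer_strictDatum_eq_awayKer`, `strictKer_le_greenbergKer`): Greenberg's UNRAMIFIED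
  condition for `M⁺_w = 0` IS Agboola's STRICT condition over the line at such a place — `Def(w) = 0`.
Frame instantiation (road α, `d ≡ 7 (mod 8)`: ramification from -w5 g4 `inertia_not_le_kerSubgroup_of_isUnramifiedOutside`, signs from (C3)
`mem_kerSubgroup_iff_smul_of_frame`, mover from B15 `natCard_localKer_vbar_eq_two_of_frame_of_kerC3` vs `…_eq_one_of_frame`, inertia triviality from the
kernel-type fixer) is the next file.

presearch: Greenberg LNM 1716 §3; Rubin LNM 1716 §3 Lemma 3.6 (ii); Serre Galois Cohomology I §2.4 — held; no new fact. beyond-print theorem: no.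

References: [GreenbergLNM1716] §3; [Rubin1999] §3 Lemma 3.6 (ii); [SerreGaloisCohomology1997] I §2.4, II §5.1; [Greenberg1989] §1 p. 98;
[Agboola2007] §3 (arXiv p0008:L58–80).
-/

set_option autoImplicit false
set_option linter.dupNamespace false

noncomputable section

open scoped Classical Pointwise
open NumberField IsDedekindDomain Field Multiplicative
open Literature.NumberTheory.EllipticCurves Literature.NumberTheory.GaloisRepresentations
  Literature.AnabelianGeometry.AbsoluteAnabelian

namespace Summit.BirchSwinnertonDyer.BirchSwinnertonDyer.Theorems.PrintCf2.LineLocallyTrivial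

/-! ## §3. Transport to `Γ_K`: unramified = strict at a ramified place of the line for a sign module with a non-inertial mover -/

section Transport

variable {K : Type} [Field K] [NumberField K] {p : ℕ} [Fact p.Prime] (κ : ZpExtension K p)
  {M : Type} [AddCommGroup M] [DistribMulAction (absoluteGaloisGroup K) M] [TopologicalSpace M] [DiscreteTopology M]

/-- **UNRAMIFIED ⟹ STRICT over the line at a RAMIFIED place, for a sign module with a non-inertial mover.** `κ` a `ℤ_p`-line ramified at `w`
(`I_w ≰ ker κ`); `M` a discrete `Γ_K`-module with open stabilisers, `2`-divisible, with at most one element of order `2`, on which `ker κ` acts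
through signs, `ker κ ⊓ I_w` acts TRIVIALLY and some `δ₀ ∈ ker κ ⊓ D_w` acts as `−1`. Then a class of `H¹(ker κ, M)` that dies on `ker κ ⊓ I_w` dies
on `ker κ ⊓ D_w` (§1 on `H_F = res⁻¹(ker κ) ≤ Γ_{K_w}` with `N = H_F ⊓ I_F`; hypotheses (U′), commutators, openness from §2).
[cite: GreenbergLNM1716, §3] [cite: Rubin1999, §3 Lemma 3.6 (ii)] [cite: SerreGaloisCohomology1997, I §2.4] -/
theorem resOfLe_inf_decomp_eq_zero_of_mover {w : HeightOneSpectrum (𝓞 K)} (hram : ¬ GreenbergSelmer.inertia w ≤ κ.kerSubgroup)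
    (hstab : ∀ m : M, IsOpen (MulAction.stabilizer (absoluteGaloisGroup K) m : Set (absoluteGaloisGroup K)))
    (hI : ∀ τ ∈ GreenbergSelmer.inertia w, τ ∈ κ.kerSubgroup → ∀ m : M, τ • m = m)
    (hpm : ∀ g ∈ κ.kerSubgroup, (∀ m : M, g • m = m) ∨ (∀ m : M, g • m = -m))
    {δ₀ : absoluteGaloisGroup K} (hδD : δ₀ ∈ GreenbergSelmer.decomp w) (hδκ : δ₀ ∈ κ.kerSubgroup) (hδ₀ : ∀ m : M, δ₀ • m = -m)
    (hdiv : ∀ m : M, ∃ m' : M, (2 : ℕ) • m' = m) (h2 : ∀ x y : M, (2 : ℕ) • x = 0 → (2 : ℕ) • y = 0 → x ≠ 0 → y ≠ 0 → x = y)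
    (y : subgroupH1 κ.kerSubgroup M) (hy : resOfLe M (inf_le_left : κ.kerSubgroup ⊓ GreenbergSelmer.inertia w ≤ κ.kerSubgroup) y = 0) :
    resOfLe M (inf_le_left : κ.kerSubgroup ⊓ GreenbergSelmer.decomp w ≤ κ.kerSubgroup) y = 0 := by
  haveI : CompactSpace (absoluteGaloisGroup (w.adicCompletion K)) := absoluteGaloisGroup_compactSpace (w.adicCompletion K)
  set res := absGaloisRestrict K (w.adicCompletion K) with hres
  set HF : Subgroup (absoluteGaloisGroup (w.adicCompletion K)) := κ.kerSubgroup.comap res.toMonoidHom with hHF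
  have hmemHF : ∀ s, s ∈ HF ↔ res s ∈ κ.kerSubgroup := fun _ ↦ Iff.rfl
  have hHFcl : IsClosed ((HF : Subgroup (absoluteGaloisGroup (w.adicCompletion K))) : Set (absoluteGaloisGroup (w.adicCompletion K))) :=
    κ.isClosed_kerSubgroup.preimage res.continuous
  -- `H_F` acts on `M` through `res`
  letI : DistribMulAction HF M := DistribMulAction.compHom M (res.toMonoidHom.comp HF.subtype)
  have hsmul : ∀ (s : HF) (m : M), s • m = res (s : absoluteGaloisGroup (w.adicCompletion K)) • m := fun _ _ ↦ rfl
  have hstab' : ∀ m : M, IsOpen (MulAction.stabilizer HF m : Set HF) := by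
    intro m
    have : (MulAction.stabilizer HF m : Set HF) =
        (fun s : HF ↦ res (s : absoluteGaloisGroup (w.adicCompletion K))) ⁻¹' (MulAction.stabilizer (absoluteGaloisGroup K) m : Set _) := by
      ext s
      simp only [SetLike.mem_coe, MulAction.mem_stabilizer_iff, Set.mem_preimage]
      exact Iff.rfl
    rw [this]
    exact (hstab m).preimage (res.continuous.comp continuous_subtype_val)
  -- the subgroup `N = H_F ⊓ I_F`
  let N : Subgroup HF := (galUnr (w.adicCompletion K)).subgroupOf HF
  have hresI : ∀ n : HF, n ∈ N → res (n : absoluteGaloisGroup (w.adicCompletion K)) ∈ GreenbergSelmer.inertia w := by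
    intro n hn
    have hn' : (n : absoluteGaloisGroup (w.adicCompletion K)) ∈ absInertia (w.adicCompletion K) := by
      rw [← galUnr_eq_absInertia]; exact Subgroup.mem_subgroupOf.mp hn
    exact ⟨n, hn', rfl⟩
  have hN : ∀ n ∈ N, ∀ m : M, n • m = m := fun n hn m ↦ by
    rw [hsmul]
    exact hI _ (hresI n hn) n.2 m
  have hcomm : ∀ g h : HF, g * h * g⁻¹ * h⁻¹ ∈ N := fun g h ↦
    Subgroup.mem_subgroupOf.mpr (by simpa only [Subgroup.coe_mul, Subgroup.coe_inv] using commutator_mem_galUnr w (g : _) h)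
  have hpm' : ∀ g : HF, (∀ m : M, g • m = m) ∨ (∀ m : M, g • m = -m) := fun g ↦ by
    simp only [hsmul]
    exact hpm _ g.2
  -- the mover, lifted to `H_F`
  obtain ⟨τ₀, hτ₀⟩ := (GreenbergSelmer.mem_decomp_iff w δ₀).mp hδD
  have hτ₀H : τ₀ ∈ HF := by rw [hmemHF, hτ₀]; exact hδκ
  have hδ₀' : ∀ m : M, (⟨τ₀, hτ₀H⟩ : HF) • m = -m := fun m ↦ by rw [hsmul]; change res τ₀ • m = -m; rw [hτ₀]; exact hδ₀ m
  -- (U′) from §2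
  have hU : ∀ U₁ U₂ : Subgroup HF, IsOpen (U₁ : Set HF) → IsOpen (U₂ : Set HF) → N ≤ U₁ → N ≤ U₂ → U₁.index = 2 → U₂.index = 2 → U₁ = U₂ :=
    fun U₁ U₂ h₁ h₂ hn₁ hn₂ hi₁ hi₂ ↦
      eq_of_isOpen_of_index_two w HF hHFcl (isOpen_comap_kerSubgroup_sup_galUnr w κ hram) U₁ U₂ h₁ h₂ hn₁ hn₂ hi₁ hi₂
  -- the class as a crossed homomorphism and its pull-back to `H_F`
  obtain ⟨f, rfl⟩ := oneCocycleClass_surjective _ y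
  rw [CocycleCriteria.resOfLe_oneCocycleClass_eq_zero_iff] at hy
  obtain ⟨m₀, hm₀⟩ := hy
  let φ : HF →ₜ* κ.kerSubgroup :=
    ⟨{ toFun := fun s ↦ ⟨res (s : absoluteGaloisGroup (w.adicCompletion K)), s.2⟩
       map_one' := Subtype.ext (map_one res)
       map_mul' := fun s t ↦ Subtype.ext (map_mul res (s : absoluteGaloisGroup (w.adicCompletion K)) t) },
      (res.continuous.comp continuous_subtype_val).subtype_mk _⟩
  have hφ : ∀ s : HF, ((φ s : κ.kerSubgroup) : absoluteGaloisGroup K) = res (s : absoluteGaloisGroup (w.adicCompletion K)) := fun _ ↦ rfl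
  let z : contOneCocycles (discreteTopRep HF M) := contOneCocycles.pullback φ (resHomOfEquivariant φ (AddMonoidHom.id M) fun _ _ ↦ rfl) f
  have hz : ∀ s : HF, z.1 s = f.1 (φ s) := fun _ ↦ rfl
  have hzN : ∀ n ∈ N, z.1 n = n • m₀ - m₀ := by
    intro n hn
    let x : ↥(κ.kerSubgroup ⊓ GreenbergSelmer.inertia w) :=
      ⟨res (n : absoluteGaloisGroup (w.adicCompletion K)), Subgroup.mem_inf.mpr ⟨n.2, hresI n hn⟩⟩
    have key := hm₀ x
    have hincl : Subgroup.inclusion (inf_le_left : κ.kerSubgroup ⊓ GreenbergSelmer.inertia w ≤ κ.kerSubgroup) x = φ n := Subtype.ext rfl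
    rw [hincl] at key
    rw [hz, hsmul]
    exact key
  -- §1
  obtain ⟨n, hn⟩ := exists_eq_smul_sub_of_mover N hN hcomm hpm' hδ₀' hdiv h2 hstab' hU z hzN
  -- conclude on `ker κ ⊓ D_w = res(H_F)`
  rw [CocycleCriteria.resOfLe_oneCocycleClass_eq_zero_iff]
  refine ⟨n, fun x ↦ ?_⟩
  obtain ⟨τ, hτ⟩ := (GreenbergSelmer.mem_decomp_iff w _).mp (Subgroup.mem_inf.mp x.2).2
  have hτH : τ ∈ HF := by rw [hmemHF, hτ]; exact (Subgroup.mem_inf.mp x.2).1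
  have h1 := hn ⟨τ, hτH⟩
  rw [hz, hsmul] at h1
  have hincl : Subgroup.inclusion (inf_le_left : κ.kerSubgroup ⊓ GreenbergSelmer.decomp w ≤ κ.kerSubgroup) x = φ ⟨τ, hτH⟩ :=
    Subtype.ext hτ.symm
  rw [hincl, h1]
  change res τ • n - n = _
  rw [hτ]

/-- **`greenbergKer (M⁺_w = 0) = awayKer` over the line at a ramified place**, for a sign module with a non-inertial mover: Greenberg's
UNRAMIFIED condition for Castella's strict datum at `w` (`mem_greenbergKer_strictDatum_iff_resOfLe`) coincides with Agboola's STRICT =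
locally-trivial condition (`BigGaloisRep.strictKer_strictDatum_eq_awayKer`) on `H¹(ker κ, M)` — the local defect `Def(w)` of (RES)(b2) vanishes.
[cite: GreenbergLNM1716, §3] [cite: Agboola2007, §3 (arXiv p0008:L58–80)] [cite: Greenberg1989, §1 p. 98] -/
theorem greenbergKer_strictDatum_eq_awayKer_of_mover {w : HeightOneSpectrum (𝓞 K)} (hram : ¬ GreenbergSelmer.inertia w ≤ κ.kerSubgroup)
    (hstab : ∀ m : M, IsOpen (MulAction.stabilizer (absoluteGaloisGroup K) m : Set (absoluteGaloisGroup K)))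
    (hI : ∀ τ ∈ GreenbergSelmer.inertia w, τ ∈ κ.kerSubgroup → ∀ m : M, τ • m = m)
    (hpm : ∀ g ∈ κ.kerSubgroup, (∀ m : M, g • m = m) ∨ (∀ m : M, g • m = -m))
    {δ₀ : absoluteGaloisGroup K} (hδD : δ₀ ∈ GreenbergSelmer.decomp w) (hδκ : δ₀ ∈ κ.kerSubgroup) (hδ₀ : ∀ m : M, δ₀ • m = -m)
    (hdiv : ∀ m : M, ∃ m' : M, (2 : ℕ) • m' = m) (h2 : ∀ x y : M, (2 : ℕ) • x = 0 → (2 : ℕ) • y = 0 → x ≠ 0 → y ≠ 0 → x = y) :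
    (Castella2018.AcSelmer.strictDatum M w).greenbergKer κ.kerSubgroup = GreenbergSelmer.awayKer κ.kerSubgroup M w := by
  ext c
  rw [mem_greenbergKer_strictDatum_iff_resOfLe]
  constructor
  · intro h
    rw [GreenbergSelmer.awayKer, AddMonoidHom.mem_ker]
    exact resOfLe_inf_decomp_eq_zero_of_mover κ hram hstab hI hpm hδD hδκ hδ₀ hdiv h2 c h
  · intro h
    rw [← BigGaloisRep.strictKer_strictDatum_eq_awayKer] at h
    exact (mem_greenbergKer_strictDatum_iff_resOfLe κ.kerSubgroup M w c).mp
      ((Castella2018.AcSelmer.strictDatum M w).strictKer_le_greenbergKer κ.kerSubgroup h)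

end Transport


end Summit.BirchSwinnertonDyer.BirchSwinnertonDyer.Theorems.PrintCf2.LineLocallyTrivial

end
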